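import Mathlib
import Summits.NavierStokesRegularity.NavierStokesRegularity.Theorems.EulerZoomLiouvillePowerGaugeEulerLiouvilleHelicityTubeMember
import Summits.NavierStokesRegularity.NavierStokesRegularity.Theorems.EulerZoomLiouvillePowerGaugeEulerLiouvilleHelicityTubeTubeTransportFree
import Summits.NavierStokesRegularity.NavierStokesRegularity.Theorems.EulerZoomLiouvillePowerGaugeEulerLiouvilleCasimirFloorTransport
import Summits.NavierStokesRegularity.NavierStokesRegularity.Theorems.EulerZoomLiouvillePowerGaugeEulerLiouvilleSwirlfreeLedgerDecay
import Summits.NavierStokesRegularity.NavierStokesRegularity.Theorems.EulerZoomLiouvillePowerGaugeEulerLiouvilleBackwardTools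
import Summits.NavierStokesRegularity.NavierStokesRegularity.Theorems.EulerZoomLiouvillePowerGaugeEulerLiouvilleChiralAnchorFarVolumeClamp
import Literature.Analysis.FluidPDE.SelfSimilarEulerProfile
import Literature.Analysis.FluidPDE.SelfSimilarCollapseAnsatz
import Literature.Analysis.FluidPDE.TaoEnstrophyLocalisation
import Literature.Analysis.FluidPDE.WeakSolution
import Literature.Analysis.FunctionSpaces.SobolevDomain
import Literature.Analysis.FunctionSpaces.SobolevBallScaling
import Literature.Analysis.FunctionSpaces.SobolevTraceDensityProofs
import Literature.Analysis.FunctionSpaces.SobolevDomainProofs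
import Literature.Analysis.FluidPDE.ClassicalSolution
import Literature.Analysis.FluidPDE.ClassicalSolutionCalculus
import Literature.Analysis.FluidPDE.VectorCalculus
import HarnessLib

/-!
# Crux `EulerZoomLiouville.PowerGaugeEulerLiouville` (stmt-NavierStokesRegularity-19832), width sub-line `chiral_anchor` (ns-idea-11 g10):
# stub K3 `stub_farVolume` — part (b): THE FAR-VOLUME BOUND as a tree theorem

Seat ns-ezl-w1 g9 (`--supports stmt-NavierStokesRegularity-19832 --as helper`; LEAD 19832 ns-typeII-p2 g16's key W1-K23, 2026-08-29 10:19Z).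
Port (verbatim, credit: ns-idea-11 g10, line file `K3.farVolumeBound_holds`, REV3) of the sub-line's in-file proof of its stub K3, with the statement
`FarVolumeBound` δ-unfolded (and the line-local predicate `IsAnchorFlow u t₁ t₀ T X` unfolded inside it), so that the K4 consumer
(`stub_anchorRace := ShellHelicityFloor → FarVolumeBound → …`, ns-ezl-w3) and the LEAD's member `InClass ρ u p H c → IsChiralTubePast u p → False` cite it BY NAME:

* `ChiralAnchor.farVolumeBound` — one constant `C` (`= 2·C_S + 1`, `C_S` the scale-invariant `W^{1,2} → L⁶` Sobolev constant on balls of `ℝ³`) such that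
  for every member of the class (any `ρ > 0`, classical), every anchor flow `X` on `[t₁,t₀]` (`−R² < t₁ < t₀ < 0`) of a measurable label set `T ⊆ B(0,R₀)`,
  every `s ∈ [t₁,t₀]`, every scale `R ≥ 2R₀` and every measurable set `E₀ ⊆ T` of labels far at time `s` (`‖X s y‖ ≥ R`):
  `vol(E₀)^{1/6} (R − R₀) ≤ C √c (√(t₀−s) R^{(1−ρ)/2} + (t₀−s) R^{−(1/2+ρ)})`.
  Proof (idea-11): the clamp `φ = g(‖·‖)` of part (a) drops from `g(R) ≥ (R−R₀)/2` to `0` along each far label, `K3.label_bound`, Tonelli, the flow's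
  change of variables and volume preservation, Hölder `(6/5, 6)`, Sobolev on `B_R` (`exists_eLpNorm_le_ball`), the `A`-gauge slice bound
  (`Backward.lintegral_ball_le_of_gaugeA`) and the `E`-gauge window bound (`SwirlfreeLedger.setLIntegral_window_frobenius_fderiv_le`).

Fill of the registered stub (by name): `theorem stub_farVolume : Sig.stub_farVolume := …Theorems.PowerGaugeEulerLiouville.ChiralAnchor.farVolumeBound`.
HONEST FRAMING: a Lagrangian travel estimate for a width sub-line of the MODEL-lattice crux class; no kill (K4 is the heart); nothing about the crux E
(19832 OPEN) or NS regularity is proved; not E.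
-/

noncomputable section

-- flat `Theorems/<Route><Decl>…` files of one crux share the namespace of the crux (tree convention)
set_option linter.dupNamespace false
set_option maxSynthPendingDepth 3

open MeasureTheory Set Filter Topology Metric
open scoped ENNReal NNReal ContDiff

namespace Summit.NavierStokesRegularity.NavierStokesRegularity.Theorems.PowerGaugeEulerLiouville.ChiralAnchor

open Literature.Analysis Literature.Analysis.FluidPDE
open Literature.Analysis.FunctionSpaces Literature.Analysis.FunctionSpaces.SobolevApprox
open Summit.NavierStokesRegularity.NavierStokesRegularity.Theorems.PowerGaugeEulerLiouville
open K3


/-- **K3 PROVED (REV3): `FarVolumeBound` holds**, with `C = 2·C_S + 1` (`C_S` the scale-invariant `W^{1,2} → L⁶` Sobolev constant on balls of `ℝ³`).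
Per label `y ∈ E₀` the clamp `φ = g(‖·‖)` (`g' = slope ∈ [0,1]`, `g ≡ 0` on `B_{R₀}`, `g` constant beyond `R`, `g(R) ≥ (R−R₀)/2`) drops from `g(R)` at time `s`
to `0` at time `t₀` along `σ ↦ X σ y`, so `g(R) ≤ ∫_s^{t₀} slope(‖Xσy‖)‖u σ (Xσy)‖ dσ` (fencing lemma); integrating over `E₀`, Tonelli, the flow's
change of variables and volume preservation, Hölder `(6/5, 6)` on `B_R ∩ X_σ(E₀)`, Sobolev on `B_R`, the `A`-gauge (`‖u(σ)‖_{L²(B_R)}² ≤ c R^{1−2ρ}`), Hölder in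
time and the `E`-gauge (`∫∫_{(−R²,0)×B_R} ‖∇u‖² ≤ c R^{1−ρ}`) give `g(R)·V₀ ≤ V₀^{5/6} C_S (R⁻¹ √(cR^{1−2ρ}) τ + √τ √(cR^{1−ρ}))`, `τ = t₀ − s`. -/
theorem farVolumeBound :
  ∃ C : ℝ, 0 < C ∧ ∀ ρ : ℝ, 0 < ρ →
    ∀ (u : ℝ → (EuclideanSpace ℝ (Fin 3)) → (EuclideanSpace ℝ (Fin 3))) (p : ℝ → (EuclideanSpace ℝ (Fin 3)) → ℝ) (H : ℝ → (EuclideanSpace ℝ (Fin 3)) → (EuclideanSpace ℝ (Fin 3)) →L[ℝ] (EuclideanSpace ℝ (Fin 3))) (c : ℝ≥0),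
      (Literature.Analysis.FluidPDE.IsSuitableWeakSolutionOn
          (Literature.Analysis.FluidPDE.slab (EuclideanSpace ℝ (Fin 3)) (Set.Iio 0) isOpen_Iio) 0 0 u p ∧
        Literature.Analysis.FluidPDE.HasWeakSpatialGradientOn
          (Literature.Analysis.FluidPDE.slab (EuclideanSpace ℝ (Fin 3)) (Set.Iio 0) isOpen_Iio) u H ∧
        (∀ a : ℝ, 0 < a →
          ENNReal.ofReal (a ^ (2 * ρ)) * Literature.Analysis.FluidPDE.cknA a (0 : ℝ × (EuclideanSpace ℝ (Fin 3))) u +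
              ENNReal.ofReal (a ^ ρ) * Literature.Analysis.FluidPDE.cknE a (0 : ℝ × (EuclideanSpace ℝ (Fin 3))) H +
            ENNReal.ofReal (a ^ (2 * ρ)) * Literature.Analysis.FluidPDE.cknD a (0 : ℝ × (EuclideanSpace ℝ (Fin 3))) p ≤ (c : ℝ≥0∞))) →
      Literature.Analysis.FluidPDE.IsClassicalEulerSolutionOn (Set.Iio 0) 0 u p →
        ∀ (t₁ t₀ : ℝ) (T : Set (EuclideanSpace ℝ (Fin 3))) (X : ℝ → (EuclideanSpace ℝ (Fin 3)) → (EuclideanSpace ℝ (Fin 3))), t₁ < t₀ → t₀ < 0 → MeasurableSet T → (Continuous (fun q : ℝ × (EuclideanSpace ℝ (Fin 3)) => X q.1 q.2) ∧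
            (∀ y ∈ T, X t₀ y = y) ∧
            (∀ r ∈ Set.Icc t₁ t₀, ∀ y ∈ T, HasDerivWithinAt (fun σ : ℝ => X σ y) (u r (X r y)) (Set.Icc t₁ t₀) r) ∧
            (∀ r ∈ Set.Icc t₁ t₀, Set.InjOn (X r) T) ∧
            (∀ r ∈ Set.Icc t₁ t₀, ∀ S ⊆ T, MeasurableSet S → MeasurableSet (X r '' S) ∧ volume (X r '' S) = volume S) ∧
            (∀ r ∈ Set.Icc t₁ t₀, ∀ S ⊆ T, MeasurableSet S → ∀ g : (EuclideanSpace ℝ (Fin 3)) → ℝ≥0∞, Measurable g →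
            ∫⁻ x in X r '' S, g x = ∫⁻ y in S, g (X r y)) ∧
            (∃ R' : ℝ, ∀ r ∈ Set.Icc t₁ t₀, X r '' T ⊆ Metric.ball (0 : (EuclideanSpace ℝ (Fin 3))) R')) →
          ∀ R₀ : ℝ, 0 < R₀ → T ⊆ Metric.ball (0 : (EuclideanSpace ℝ (Fin 3))) R₀ →
            ∀ R : ℝ, 2 * R₀ ≤ R → -R ^ 2 < t₁ →
              ∀ s ∈ Set.Icc t₁ t₀, ∀ E₀ ⊆ T, MeasurableSet E₀ → (∀ y ∈ E₀, R ≤ ‖X s y‖) →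
                (volume E₀).toReal ^ (1 / 6 : ℝ) * (R - R₀) ≤
                  C * Real.sqrt (c : ℝ) * (Real.sqrt (t₀ - s) * R ^ ((1 - ρ) / 2) + (t₀ - s) * R ^ (-(1 / 2 + ρ))) := by
  classical
  have hfin : (Module.finrank ℝ (EuclideanSpace ℝ (Fin 3)) : ℝ) = 3 := by simp
  obtain ⟨CS, hCS⟩ := exists_eLpNorm_le_ball (E := (EuclideanSpace ℝ (Fin 3))) (F := (EuclideanSpace ℝ (Fin 3))) (p := 2) (p' := 6) (by norm_num)
    (by rw [hfin]; norm_num) (by rw [hfin]; norm_num)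
  refine ⟨2 * (CS : ℝ) + 1, by positivity, ?_⟩
  intro ρ hρ u p H c hcls hcl t₁ t₀ T X ht₁ ht₀ hT hX R₀ hR₀ hTR₀ R hR hRt₁ s hs E₀ hE₀T hE₀m hfar
  obtain ⟨hXc, hXid, hXd, hXinj, hXvol, hXcov, hXbdd⟩ := hX
  obtain ⟨_, hH, hgauge⟩ := hcls
  have hA : ∀ a : ℝ, 0 < a → ENNReal.ofReal (a ^ (2 * ρ)) * cknA a (0 : ℝ × (EuclideanSpace ℝ (Fin 3))) u ≤ (c : ℝ≥0∞) :=
    fun a ha => le_trans (le_trans le_self_add le_self_add) (hgauge a ha)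
  have hE : ∀ a : ℝ, 0 < a → ENNReal.ofReal (a ^ ρ) * cknE a (0 : ℝ × (EuclideanSpace ℝ (Fin 3))) H ≤ (c : ℝ≥0∞) :=
    fun a ha => le_trans (le_trans le_add_self le_self_add) (hgauge a ha)
  have hR0 : 0 < R := by linarith
  set δ : ℝ := (R - R₀) / 4 with hδdef
  have hδ : 0 < δ := by rw [hδdef]; linarith
  have ht₁t₀ : t₁ ≤ t₀ := ht₁.le
  have hIcc0 : Icc t₁ t₀ ⊆ Iio 0 := fun r hr => lt_of_le_of_lt hr.2 ht₀
  have hu_cont : ContinuousOn (Function.uncurry u) (Iio (0 : ℝ) ×ˢ (univ : Set (EuclideanSpace ℝ (Fin 3)))) :=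
    hcl.smooth_velocity.continuousOn
  have hlabel : ∀ y ∈ E₀, prof R₀ R δ R ≤ ∫ σ in s..t₀, slope R₀ R δ ‖X σ y‖ * ‖u σ (X σ y)‖ := by
    intro y hy
    have hyT : y ∈ T := hE₀T hy
    have h1 : clamp R₀ R δ (X s y) = prof R₀ R δ R := by
      rw [clamp]; exact prof_eq_of_ge hδ (hfar y hy)
    have h2 : clamp R₀ R δ (X t₀ y) = 0 := by
      rw [clamp, hXid y hyT]
      have : ‖y‖ < R₀ := by simpa using hTR₀ hyT
      exact prof_eq_zero_of_le hR₀.le hδ this.le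
    have := label_bound (R := R) hR₀ hδ ht₀ hs hu_cont hXc (fun r hr => hXd r hr y hyT)
    rw [h1, h2, sub_zero] at this
    exact this
  set I : Set ℝ := Ioo s t₀ with hIdef
  have hIm : MeasurableSet I := measurableSet_Ioo
  have hI_Icc : I ⊆ Icc t₁ t₀ := fun σ hσ => ⟨hs.1.trans hσ.1.le, hσ.2.le⟩
  have hI0 : I ⊆ Iio 0 := hI_Icc.trans hIcc0
  set F : (EuclideanSpace ℝ (Fin 3)) → ℝ → ℝ≥0∞ := fun y σ => ENNReal.ofReal (slope R₀ R δ ‖X σ y‖ * ‖u σ (X σ y)‖) with hFdef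
  have hB : ENNReal.ofReal (prof R₀ R δ R) * volume E₀ ≤ ∫⁻ y in E₀, ∫⁻ σ in I, F y σ := by
    rw [← setLIntegral_const]
    refine lintegral_mono_ae ((ae_restrict_iff' hE₀m).2 (ae_of_all _ fun y hy => ?_))
    have hyT : y ∈ T := hE₀T hy
    have hXy : Continuous fun σ : ℝ => X σ y := hXc.comp (continuous_id.prodMk continuous_const)
    have hbc : ContinuousOn (fun σ : ℝ => slope R₀ R δ ‖X σ y‖ * ‖u σ (X σ y)‖) (Iio 0) := by
      have h1 : Continuous fun σ : ℝ => slope R₀ R δ ‖X σ y‖ :=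
        (slope_continuous R₀ R δ).comp (continuous_norm.comp hXy)
      have h2 : ContinuousOn (fun σ : ℝ => u σ (X σ y)) (Iio 0) := by
        have hmap : MapsTo (fun σ : ℝ => ((σ, X σ y) : ℝ × (EuclideanSpace ℝ (Fin 3)))) (Iio 0) (Iio (0 : ℝ) ×ˢ (univ : Set (EuclideanSpace ℝ (Fin 3)))) :=
          fun σ hσ => mk_mem_prod hσ (mem_univ _)
        exact hu_cont.comp (continuous_id.prodMk hXy).continuousOn hmap
      exact h1.continuousOn.mul h2.norm
    have hint : IntegrableOn (fun σ : ℝ => slope R₀ R δ ‖X σ y‖ * ‖u σ (X σ y)‖) (Ioc s t₀) volume :=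
      ((hbc.mono ((Icc_subset_Icc hs.1 le_rfl).trans hIcc0)).integrableOn_compact isCompact_Icc).mono_set
        Ioc_subset_Icc_self
    have hnn : 0 ≤ᵐ[volume.restrict (Ioc s t₀)] fun σ : ℝ => slope R₀ R δ ‖X σ y‖ * ‖u σ (X σ y)‖ :=
      ae_of_all _ fun σ => mul_nonneg (slope_nonneg _ _ _ _) (norm_nonneg _)
    calc ENNReal.ofReal (prof R₀ R δ R)
        ≤ ENNReal.ofReal (∫ σ in s..t₀, slope R₀ R δ ‖X σ y‖ * ‖u σ (X σ y)‖) :=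
          ENNReal.ofReal_le_ofReal (hlabel y hy)
      _ = ∫⁻ σ in Ioc s t₀, F y σ := by
          rw [intervalIntegral.integral_of_le hs.2, ofReal_integral_eq_lintegral_ofReal hint hnn]
      _ = ∫⁻ σ in I, F y σ := setLIntegral_congr Ioo_ae_eq_Ioc.symm
  have hFm : AEMeasurable (Function.uncurry F) ((volume.restrict E₀).prod (volume.restrict I)) := by
    rw [Measure.prod_restrict, ← Measure.volume_eq_prod]
    have hcont : ContinuousOn (Function.uncurry F) ((univ : Set (EuclideanSpace ℝ (Fin 3))) ×ˢ Iio (0 : ℝ)) := by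
      have hX' : Continuous fun q : (EuclideanSpace ℝ (Fin 3)) × ℝ => X q.2 q.1 := hXc.comp (continuous_snd.prodMk continuous_fst)
      have h1 : Continuous fun q : (EuclideanSpace ℝ (Fin 3)) × ℝ => slope R₀ R δ ‖X q.2 q.1‖ :=
        (slope_continuous R₀ R δ).comp (continuous_norm.comp hX')
      have h2 : ContinuousOn (fun q : (EuclideanSpace ℝ (Fin 3)) × ℝ => u q.2 (X q.2 q.1)) ((univ : Set (EuclideanSpace ℝ (Fin 3))) ×ˢ Iio (0 : ℝ)) := by
        have hmap : MapsTo (fun q : (EuclideanSpace ℝ (Fin 3)) × ℝ => ((q.2, X q.2 q.1) : ℝ × (EuclideanSpace ℝ (Fin 3)))) ((univ : Set (EuclideanSpace ℝ (Fin 3))) ×ˢ Iio (0 : ℝ))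
            (Iio (0 : ℝ) ×ˢ (univ : Set (EuclideanSpace ℝ (Fin 3)))) := fun q hq => mk_mem_prod hq.2 (mem_univ _)
        exact hu_cont.comp (continuous_snd.prodMk hX').continuousOn hmap
      exact ENNReal.continuous_ofReal.comp_continuousOn (h1.continuousOn.mul h2.norm)
    exact (hcont.mono (prod_mono (subset_univ _) hI0)).aemeasurable (hE₀m.prod hIm)
  have hC : ∫⁻ y in E₀, ∫⁻ σ in I, F y σ = ∫⁻ σ in I, ∫⁻ y in E₀, F y σ := lintegral_lintegral_swap hFm
  set V₀ : ℝ≥0∞ := volume E₀ with hV₀def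
  have hV₀fin : V₀ ≠ ⊤ :=
    ((measure_mono (hE₀T.trans hTR₀)).trans_lt (measure_ball_lt_top (μ := volume) (x := (0 : (EuclideanSpace ℝ (Fin 3)))) (r := R₀))).ne
  set μR : Measure (EuclideanSpace ℝ (Fin 3)) := volume.restrict (ball (0 : (EuclideanSpace ℝ (Fin 3))) R) with hμRdef
  set MA : ℝ≥0∞ := (ENNReal.ofReal ((c : ℝ) * R ^ (1 - 2 * ρ))) ^ (1 / 2 : ℝ) with hMAdef
  set Gd : ℝ → ℝ≥0∞ := fun σ => (∫⁻ x in ball (0 : (EuclideanSpace ℝ (Fin 3))) R, ‖fderiv ℝ (u σ) x‖ₑ ^ (2 : ℝ)) ^ (1 / 2 : ℝ)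
    with hGddef
  have hL6 : ∀ f : (EuclideanSpace ℝ (Fin 3)) → (EuclideanSpace ℝ (Fin 3)), eLpNorm f ((6 : ℝ≥0) : ℝ≥0∞) μR = (∫⁻ x, ‖f x‖ₑ ^ (6 : ℝ) ∂μR) ^ (1 / 6 : ℝ) := by
    intro f
    rw [eLpNorm_eq_lintegral_rpow_enorm_toReal (by norm_num) ENNReal.coe_ne_top]
    simp only [ENNReal.coe_toReal, NNReal.coe_ofNat]
  have hL2 : ∀ {G : Type} [NormedAddCommGroup G] (f : (EuclideanSpace ℝ (Fin 3)) → G),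
      eLpNorm f ((2 : ℝ≥0) : ℝ≥0∞) μR = (∫⁻ x, ‖f x‖ₑ ^ (2 : ℝ) ∂μR) ^ (1 / 2 : ℝ) := by
    intro G _ f
    rw [eLpNorm_eq_lintegral_rpow_enorm_toReal (by norm_num) ENNReal.coe_ne_top]
    simp only [ENNReal.coe_toReal, NNReal.coe_ofNat]
  have hD : ∀ σ ∈ I, ∫⁻ y in E₀, F y σ ≤
      V₀ ^ (5 / 6 : ℝ) * ((CS : ℝ≥0∞) * ((ENNReal.ofReal R)⁻¹ * MA + Gd σ)) := by
    intro σ hσ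
    have hσIcc : σ ∈ Icc t₁ t₀ := hI_Icc hσ
    have hσ0 : σ ∈ Iio (0 : ℝ) := hI0 hσ
    have hσR : σ ∈ Ioo (-(R ^ 2)) 0 := ⟨lt_of_lt_of_le hRt₁ (hs.1.trans hσ.1.le), hσ0⟩
    have hv : ContDiff ℝ 1 (u σ) := (hcl.contDiff_velocity hσ0).of_le (by norm_cast)
    have hvc : Continuous (u σ) := hv.continuous
    set g : (EuclideanSpace ℝ (Fin 3)) → ℝ≥0∞ := fun x => ENNReal.ofReal (slope R₀ R δ ‖x‖ * ‖u σ x‖) with hgdef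
    have hgm : Measurable g :=
      ENNReal.measurable_ofReal.comp (((slope_continuous R₀ R δ).comp continuous_norm).mul hvc.norm).measurable
    have hcov : ∫⁻ y in E₀, F y σ = ∫⁻ x in X σ '' E₀, g x := (hXcov σ hσIcc E₀ hE₀T hE₀m g hgm).symm
    obtain ⟨hAm, hAvol⟩ := hXvol σ hσIcc E₀ hE₀T hE₀m
    have hpt : ∀ x, g x ≤ (ball (0 : (EuclideanSpace ℝ (Fin 3))) R).indicator (fun x => ‖u σ x‖ₑ) x := by
      intro x
      by_cases hx : x ∈ ball (0 : (EuclideanSpace ℝ (Fin 3))) R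
      · rw [indicator_of_mem hx, hgdef]
        simp only
        rw [← ofReal_norm]
        refine ENNReal.ofReal_le_ofReal ?_
        have h1 := slope_le_one R₀ R δ ‖x‖
        have h2 := norm_nonneg (u σ x)
        nlinarith
      · rw [indicator_of_notMem hx, hgdef]
        simp only
        have hx' : R ≤ ‖x‖ := by simpa [mem_ball, dist_zero_right, not_lt] using hx
        rw [slope_eq_zero_of_ge hδ hx', zero_mul, ENNReal.ofReal_zero]
    set A' : Set (EuclideanSpace ℝ (Fin 3)) := ball (0 : (EuclideanSpace ℝ (Fin 3))) R ∩ X σ '' E₀ with hA'def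
    have h1 : ∫⁻ x in X σ '' E₀, g x ≤ ∫⁻ x in A', ‖u σ x‖ₑ := by
      calc ∫⁻ x in X σ '' E₀, g x ≤ ∫⁻ x in X σ '' E₀, (ball (0 : (EuclideanSpace ℝ (Fin 3))) R).indicator (fun x => ‖u σ x‖ₑ) x :=
            lintegral_mono fun x => hpt x
        _ = ∫⁻ x in A', ‖u σ x‖ₑ := by
            rw [lintegral_indicator measurableSet_ball, Measure.restrict_restrict measurableSet_ball]
    have hp65 : (6 / 5 : ℝ).HolderConjugate 6 := by rw [Real.holderConjugate_iff]; norm_num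
    have h2 : ∫⁻ x in A', ‖u σ x‖ₑ ≤ (volume A') ^ (5 / 6 : ℝ) * (∫⁻ x in A', ‖u σ x‖ₑ ^ (6 : ℝ)) ^ (1 / 6 : ℝ) := by
      have := ENNReal.lintegral_mul_le_Lp_mul_Lq (volume.restrict A') hp65 (f := fun _ => (1 : ℝ≥0∞))
        (g := fun x => ‖u σ x‖ₑ) aemeasurable_const hvc.measurable.enorm.aemeasurable
      have e1 : (fun a : (EuclideanSpace ℝ (Fin 3)) => ((fun _ : (EuclideanSpace ℝ (Fin 3)) => (1 : ℝ≥0∞)) * fun x => ‖u σ x‖ₑ) a) = fun x => ‖u σ x‖ₑ := by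
        funext a; simp
      rw [e1] at this
      simp only [ENNReal.one_rpow, lintegral_const, Measure.restrict_apply_univ, one_mul] at this
      have e2 : (1 / (6 / 5 : ℝ)) = (5 / 6 : ℝ) := by norm_num
      rw [e2] at this
      exact this
    have h3 : (volume A') ^ (5 / 6 : ℝ) ≤ V₀ ^ (5 / 6 : ℝ) :=
      ENNReal.rpow_le_rpow ((measure_mono inter_subset_right).trans hAvol.le) (by norm_num)
    have h4 : (∫⁻ x in A', ‖u σ x‖ₑ ^ (6 : ℝ)) ^ (1 / 6 : ℝ) ≤ eLpNorm (u σ) ((6 : ℝ≥0) : ℝ≥0∞) μR := by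
      rw [hL6]
      exact ENNReal.rpow_le_rpow (lintegral_mono_set inter_subset_left) (by norm_num)
    have hSob := hCS 0 R hR0 (u σ) (fderiv ℝ (u σ))
      (memSobolevDomain_one_of_contDiff (Ω := ⟨ball (0 : (EuclideanSpace ℝ (Fin 3))) R, isOpen_ball⟩) hv isBounded_ball)
      (HasWeakFDerivOn.of_contDiff_holds (E' := (EuclideanSpace ℝ (Fin 3))) (F := (EuclideanSpace ℝ (Fin 3))) ⟨ball (0 : (EuclideanSpace ℝ (Fin 3))) R, isOpen_ball⟩ volume hv)
    rw [← hμRdef] at hSob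
    have h5 : eLpNorm (u σ) ((2 : ℝ≥0) : ℝ≥0∞) μR ≤ MA := by
      rw [hL2, hMAdef]
      refine ENNReal.rpow_le_rpow ?_ (by norm_num)
      have := Backward.lintegral_ball_le_of_gaugeA (u := u) hR0 (hA R hR0) hσR
      simpa only [ENNReal.rpow_two] using this
    have h6 : eLpNorm (fderiv ℝ (u σ)) ((2 : ℝ≥0) : ℝ≥0∞) μR = Gd σ := by rw [hL2]
    calc ∫⁻ y in E₀, F y σ = ∫⁻ x in X σ '' E₀, g x := hcov
      _ ≤ ∫⁻ x in A', ‖u σ x‖ₑ := h1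
      _ ≤ (volume A') ^ (5 / 6 : ℝ) * (∫⁻ x in A', ‖u σ x‖ₑ ^ (6 : ℝ)) ^ (1 / 6 : ℝ) := h2
      _ ≤ V₀ ^ (5 / 6 : ℝ) * eLpNorm (u σ) ((6 : ℝ≥0) : ℝ≥0∞) μR := mul_le_mul' h3 h4
      _ ≤ V₀ ^ (5 / 6 : ℝ) * ((CS : ℝ≥0∞) * ((ENNReal.ofReal R)⁻¹ * eLpNorm (u σ) ((2 : ℝ≥0) : ℝ≥0∞) μR +
            eLpNorm (fderiv ℝ (u σ)) ((2 : ℝ≥0) : ℝ≥0∞) μR)) := mul_le_mul' le_rfl hSob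
      _ ≤ V₀ ^ (5 / 6 : ℝ) * ((CS : ℝ≥0∞) * ((ENNReal.ofReal R)⁻¹ * MA + Gd σ)) := by
            rw [h6]; gcongr
  set τ : ℝ := t₀ - s with hτdef
  have hτ : 0 ≤ τ := by rw [hτdef]; linarith [hs.2]
  have hvolI : volume I = ENNReal.ofReal τ := by rw [hIdef, Real.volume_Ioo]
  have hIR : I ⊆ Ioo (-(R ^ 2)) 0 := fun σ hσ => ⟨lt_of_lt_of_le hRt₁ (hs.1.trans hσ.1.le), hI0 hσ⟩
  set ME : ℝ≥0∞ := (ENNReal.ofReal ((c : ℝ) * R ^ (1 - ρ))) ^ (1 / 2 : ℝ) with hMEdef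
  have hD_cont : ContinuousOn (Function.uncurry fun t x => fderiv ℝ (u t) x) (Iio (0 : ℝ) ×ˢ (univ : Set (EuclideanSpace ℝ (Fin 3)))) :=
    (hcl.smooth_velocity.fderiv_slice isOpen_Iio.uniqueDiffOn).continuousOn
  have hGi : ∀ J : Set ℝ, J ⊆ Iio 0 → MeasurableSet J →
      AEMeasurable (Function.uncurry fun (σ : ℝ) (x : (EuclideanSpace ℝ (Fin 3))) => ‖fderiv ℝ (u σ) x‖ₑ ^ (2 : ℝ))
        ((volume.restrict J).prod (volume.restrict (ball (0 : (EuclideanSpace ℝ (Fin 3))) R))) := by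
    intro J hJ0 hJm
    rw [Measure.prod_restrict, ← Measure.volume_eq_prod]
    have hDm : AEMeasurable (Function.uncurry fun t x => fderiv ℝ (u t) x)
        (volume.restrict (J ×ˢ ball (0 : (EuclideanSpace ℝ (Fin 3))) R)) :=
      (hD_cont.mono (prod_mono hJ0 (subset_univ _))).aemeasurable (hJm.prod measurableSet_ball)
    exact hDm.enorm.pow_const _
  have hGdm : AEMeasurable Gd (volume.restrict I) := (hGi I hI0 hIm).lintegral_prod_right'.pow_const _
  have hwindow : ∫⁻ σ in I, Gd σ ^ (2 : ℝ) ≤ ENNReal.ofReal ((c : ℝ) * R ^ (1 - ρ)) := by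
    have e2 : ∀ σ, Gd σ ^ (2 : ℝ) = ∫⁻ x in ball (0 : (EuclideanSpace ℝ (Fin 3))) R, ‖fderiv ℝ (u σ) x‖ₑ ^ (2 : ℝ) := by
      intro σ; rw [hGddef]; simp only; rw [← ENNReal.rpow_mul]; norm_num
    simp_rw [e2]
    have hpt : ∀ z : ℝ × (EuclideanSpace ℝ (Fin 3)), ‖fderiv ℝ (u z.1) z.2‖ₑ ^ (2 : ℝ) ≤
        ENNReal.ofReal (frobeniusNormSq (fderiv ℝ (u z.1) z.2)) := by
      intro z
      rw [ENNReal.rpow_two, ← ofReal_norm, ← ENNReal.ofReal_pow (norm_nonneg _)]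
      exact ENNReal.ofReal_le_ofReal (sq_opNorm_le_frobeniusNormSq _)
    calc ∫⁻ σ in I, ∫⁻ x in ball (0 : (EuclideanSpace ℝ (Fin 3))) R, ‖fderiv ℝ (u σ) x‖ₑ ^ (2 : ℝ)
        ≤ ∫⁻ σ in Ioo (-(R ^ 2)) 0, ∫⁻ x in ball (0 : (EuclideanSpace ℝ (Fin 3))) R, ‖fderiv ℝ (u σ) x‖ₑ ^ (2 : ℝ) :=
          lintegral_mono_set hIR
      _ = ∫⁻ z in Ioo (-(R ^ 2)) 0 ×ˢ ball (0 : (EuclideanSpace ℝ (Fin 3))) R, ‖fderiv ℝ (u z.1) z.2‖ₑ ^ (2 : ℝ) := by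
          rw [lintegral_lintegral (hGi _ Ioo_subset_Iio_self measurableSet_Ioo), Measure.prod_restrict,
            ← Measure.volume_eq_prod]
      _ ≤ ∫⁻ z in Ioo (-(R ^ 2)) 0 ×ˢ ball (0 : (EuclideanSpace ℝ (Fin 3))) R, ENNReal.ofReal (frobeniusNormSq (fderiv ℝ (u z.1) z.2)) :=
          lintegral_mono fun z => hpt z
      _ ≤ ENNReal.ofReal ((c : ℝ) * R ^ (1 - ρ)) :=
          SwirlfreeLedger.setLIntegral_window_frobenius_fderiv_le hH hcl hE hR0
  have hGd_int : ∫⁻ σ in I, Gd σ ≤ (ENNReal.ofReal τ) ^ (1 / 2 : ℝ) * ME := by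
    have hH2 := ENNReal.lintegral_mul_le_Lp_mul_Lq (volume.restrict I) Real.HolderConjugate.two_two
      (f := fun _ => (1 : ℝ≥0∞)) (g := Gd) aemeasurable_const hGdm
    have e1 : (fun a : ℝ => ((fun _ : ℝ => (1 : ℝ≥0∞)) * Gd) a) = Gd := by funext a; simp
    rw [e1] at hH2
    simp only [ENNReal.one_rpow, lintegral_const, Measure.restrict_apply_univ, one_mul] at hH2
    rw [hvolI] at hH2
    refine hH2.trans (mul_le_mul' le_rfl ?_)
    rw [hMEdef]
    exact ENNReal.rpow_le_rpow hwindow (by norm_num)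
  have hEtot : ∫⁻ σ in I, ∫⁻ y in E₀, F y σ ≤
      V₀ ^ (5 / 6 : ℝ) * ((CS : ℝ≥0∞) * ((ENNReal.ofReal R)⁻¹ * MA * ENNReal.ofReal τ +
        (ENNReal.ofReal τ) ^ (1 / 2 : ℝ) * ME)) := by
    calc ∫⁻ σ in I, ∫⁻ y in E₀, F y σ
        ≤ ∫⁻ σ in I, V₀ ^ (5 / 6 : ℝ) * ((CS : ℝ≥0∞) * ((ENNReal.ofReal R)⁻¹ * MA + Gd σ)) :=
          lintegral_mono_ae ((ae_restrict_iff' hIm).2 (ae_of_all _ fun σ hσ => hD σ hσ))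
      _ = V₀ ^ (5 / 6 : ℝ) * ((CS : ℝ≥0∞) * ((ENNReal.ofReal R)⁻¹ * MA * volume I + ∫⁻ σ in I, Gd σ)) := by
          rw [lintegral_const_mul' _ _ (ENNReal.rpow_ne_top_of_nonneg (by norm_num) hV₀fin),
            lintegral_const_mul' _ _ ENNReal.coe_ne_top, lintegral_add_left measurable_const, setLIntegral_const]
      _ ≤ V₀ ^ (5 / 6 : ℝ) * ((CS : ℝ≥0∞) * ((ENNReal.ofReal R)⁻¹ * MA * ENNReal.ofReal τ +
            (ENNReal.ofReal τ) ^ (1 / 2 : ℝ) * ME)) := by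
          rw [hvolI]; gcongr
  have hmain : ENNReal.ofReal (prof R₀ R δ R) * V₀ ≤
      V₀ ^ (5 / 6 : ℝ) * ((CS : ℝ≥0∞) * ((ENNReal.ofReal R)⁻¹ * MA * ENNReal.ofReal τ +
        (ENNReal.ofReal τ) ^ (1 / 2 : ℝ) * ME)) := hB.trans (hC.le.trans hEtot)
  have hprofR : (R - R₀) / 2 ≤ prof R₀ R δ R := prof_R_ge hR₀ hR hδdef
  have hprof0 : 0 ≤ prof R₀ R δ R := le_trans (by linarith) hprofR
  have hc0 : 0 ≤ (c : ℝ) := c.coe_nonneg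
  have hcA : 0 ≤ (c : ℝ) * R ^ (1 - 2 * ρ) := mul_nonneg hc0 (Real.rpow_nonneg hR0.le _)
  have hcE : 0 ≤ (c : ℝ) * R ^ (1 - ρ) := mul_nonneg hc0 (Real.rpow_nonneg hR0.le _)
  set mA : ℝ := ((c : ℝ) * R ^ (1 - 2 * ρ)) ^ (1 / 2 : ℝ) with hmAdef
  set mE : ℝ := ((c : ℝ) * R ^ (1 - ρ)) ^ (1 / 2 : ℝ) with hmEdef
  set τh : ℝ := τ ^ (1 / 2 : ℝ) with hτhdef
  have hmA0 : 0 ≤ mA := Real.rpow_nonneg hcA _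
  have hmE0 : 0 ≤ mE := Real.rpow_nonneg hcE _
  have hτh0 : 0 ≤ τh := Real.rpow_nonneg hτ _
  have eMA : ENNReal.ofReal mA = MA := by rw [hMAdef, hmAdef, ENNReal.ofReal_rpow_of_nonneg hcA (by norm_num)]
  have eME : ENNReal.ofReal mE = ME := by rw [hMEdef, hmEdef, ENNReal.ofReal_rpow_of_nonneg hcE (by norm_num)]
  have eτh : ENNReal.ofReal τh = (ENNReal.ofReal τ) ^ (1 / 2 : ℝ) := by
    rw [hτhdef, ENNReal.ofReal_rpow_of_nonneg hτ (by norm_num)]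
  set rhs : ℝ := (CS : ℝ) * (R⁻¹ * mA * τ + τh * mE) with hrhsdef
  have hrhs0 : 0 ≤ rhs := by rw [hrhsdef]; positivity
  have erhs : ENNReal.ofReal rhs =
      (CS : ℝ≥0∞) * ((ENNReal.ofReal R)⁻¹ * MA * ENNReal.ofReal τ + (ENNReal.ofReal τ) ^ (1 / 2 : ℝ) * ME) := by
    rw [hrhsdef, ENNReal.ofReal_mul (NNReal.coe_nonneg CS), ENNReal.ofReal_coe_nnreal,
      ENNReal.ofReal_add (by positivity) (by positivity), ENNReal.ofReal_mul (by positivity),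
      ENNReal.ofReal_mul (inv_nonneg.2 hR0.le), ENNReal.ofReal_inv_of_pos hR0, ENNReal.ofReal_mul hτh0, eMA, eME, eτh]
  have hform : R⁻¹ * mA * τ + τh * mE =
      Real.sqrt (c : ℝ) * (Real.sqrt τ * R ^ ((1 - ρ) / 2) + τ * R ^ (-(1 / 2 + ρ))) := by
    have hA' : mA = Real.sqrt (c : ℝ) * R ^ ((1 - 2 * ρ) / 2) := by
      rw [hmAdef, Real.mul_rpow hc0 (Real.rpow_nonneg hR0.le _), ← Real.rpow_mul hR0.le, ← Real.sqrt_eq_rpow]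
      congr 1; ring_nf
    have hE' : mE = Real.sqrt (c : ℝ) * R ^ ((1 - ρ) / 2) := by
      rw [hmEdef, Real.mul_rpow hc0 (Real.rpow_nonneg hR0.le _), ← Real.rpow_mul hR0.le, ← Real.sqrt_eq_rpow]
      congr 1; ring_nf
    have hτ' : τh = Real.sqrt τ := by rw [hτhdef, Real.sqrt_eq_rpow]
    have hpow : R⁻¹ * R ^ ((1 - 2 * ρ) / 2) = R ^ (-(1 / 2 + ρ)) := by
      rw [← Real.rpow_neg_one, ← Real.rpow_add hR0]
      congr 1; ring
    rw [hA', hE', hτ']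
    calc R⁻¹ * (Real.sqrt (c : ℝ) * R ^ ((1 - 2 * ρ) / 2)) * τ + Real.sqrt τ * (Real.sqrt (c : ℝ) * R ^ ((1 - ρ) / 2))
        = Real.sqrt (c : ℝ) * (Real.sqrt τ * R ^ ((1 - ρ) / 2) + τ * (R⁻¹ * R ^ ((1 - 2 * ρ) / 2))) := by ring
      _ = Real.sqrt (c : ℝ) * (Real.sqrt τ * R ^ ((1 - ρ) / 2) + τ * R ^ (-(1 / 2 + ρ))) := by rw [hpow]
  have htarget0 : 0 ≤ Real.sqrt (c : ℝ) * (Real.sqrt τ * R ^ ((1 - ρ) / 2) + τ * R ^ (-(1 / 2 + ρ))) := by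
    have := Real.rpow_nonneg hR0.le ((1 - ρ) / 2)
    have := Real.rpow_nonneg hR0.le (-(1 / 2 + ρ))
    positivity
  by_cases hV0 : V₀ = 0
  · -- trivial case
    have : V₀.toReal ^ (1 / 6 : ℝ) = 0 := by rw [hV0, ENNReal.toReal_zero, Real.zero_rpow (by norm_num)]
    rw [this, zero_mul]
    calc (0 : ℝ) ≤ (2 * (CS : ℝ) + 1) * (Real.sqrt (c : ℝ) * (Real.sqrt τ * R ^ ((1 - ρ) / 2) + τ * R ^ (-(1 / 2 + ρ)))) :=
          mul_nonneg (by positivity) htarget0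
      _ = _ := by ring
  · -- divide by `V₀ ^ (5/6)` and pass to reals
    have hsplit : V₀ = V₀ ^ (5 / 6 : ℝ) * V₀ ^ (1 / 6 : ℝ) := by
      rw [← ENNReal.rpow_add _ _ hV0 hV₀fin]; norm_num
    have h56_0 : V₀ ^ (5 / 6 : ℝ) ≠ 0 := by
      intro h; exact hV0 ((ENNReal.rpow_eq_zero_iff_of_pos (by norm_num)).1 h)
    have h56_top : V₀ ^ (5 / 6 : ℝ) ≠ ⊤ := ENNReal.rpow_ne_top_of_nonneg (by norm_num) hV₀fin
    have hmain' : ENNReal.ofReal (prof R₀ R δ R) * V₀ ^ (1 / 6 : ℝ) ≤ ENNReal.ofReal rhs := by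
      rw [erhs]
      refine (ENNReal.mul_le_mul_iff_right h56_0 h56_top).1 ?_
      calc V₀ ^ (5 / 6 : ℝ) * (ENNReal.ofReal (prof R₀ R δ R) * V₀ ^ (1 / 6 : ℝ))
          = ENNReal.ofReal (prof R₀ R δ R) * V₀ := by
            conv_rhs => rw [hsplit]
            ring
        _ ≤ _ := hmain
    have hreal : prof R₀ R δ R * V₀.toReal ^ (1 / 6 : ℝ) ≤ rhs := by
      have e : ENNReal.ofReal (prof R₀ R δ R) * V₀ ^ (1 / 6 : ℝ) =
          ENNReal.ofReal (prof R₀ R δ R * V₀.toReal ^ (1 / 6 : ℝ)) := by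
        rw [ENNReal.ofReal_mul hprof0, ← ENNReal.ofReal_rpow_of_nonneg (ENNReal.toReal_nonneg (a := V₀)) (by norm_num),
          ENNReal.ofReal_toReal hV₀fin]
      rw [e] at hmain'
      exact (ENNReal.ofReal_le_ofReal_iff hrhs0).1 hmain'
    have hV16 : 0 ≤ V₀.toReal ^ (1 / 6 : ℝ) := Real.rpow_nonneg ENNReal.toReal_nonneg _
    rw [hrhsdef, hform] at hreal
    calc V₀.toReal ^ (1 / 6 : ℝ) * (R - R₀) ≤ V₀.toReal ^ (1 / 6 : ℝ) * (2 * prof R₀ R δ R) :=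
          mul_le_mul_of_nonneg_left (by linarith) hV16
      _ = 2 * (prof R₀ R δ R * V₀.toReal ^ (1 / 6 : ℝ)) := by ring
      _ ≤ 2 * ((CS : ℝ) * (Real.sqrt (c : ℝ) * (Real.sqrt τ * R ^ ((1 - ρ) / 2) + τ * R ^ (-(1 / 2 + ρ))))) :=
          by linarith
      _ = (2 * (CS : ℝ)) * Real.sqrt (c : ℝ) * (Real.sqrt τ * R ^ ((1 - ρ) / 2) + τ * R ^ (-(1 / 2 + ρ))) := by ring
      _ ≤ (2 * (CS : ℝ) + 1) * Real.sqrt (c : ℝ) * (Real.sqrt τ * R ^ ((1 - ρ) / 2) + τ * R ^ (-(1 / 2 + ρ))) := by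
          rw [mul_assoc, mul_assoc (2 * (CS : ℝ) + 1)]
          exact mul_le_mul_of_nonneg_right (by linarith) htarget0

end Summit.NavierStokesRegularity.NavierStokesRegularity.Theorems.PowerGaugeEulerLiouville.ChiralAnchor

end
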